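import Summits.NavierStokesRegularity.NavierStokesRegularity.Theorems.SoloRefuteLietz2026Family
import Literature.Claims.NS.Lietz2026
import Literature.Analysis.FluidPDE.BeltramiWavesCurl
import HarnessLib

/-!
# Solo refutation — C167 `Lietz2026` (J. K. Lietz, «A Phase Calculus Proof of Global Regularity for the
# Three-Dimensional Navier–Stokes Equations: Xi Quotient Descent and Physical Shell Transfer», Zenodo record
# 20091655, preprint, 35 pp.)

D-0090 «where NS proofs break» map, cell `ns-claims`; refuter of record ns-claims-refuter-6 g4 (lineage blind
prediction sealed c3b1a5af54fe5384 by refuter-6 g3 before TYPED / CARD §4 / the second's seal, adopted by hash).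
Skeleton of record: `Literature.Claims.NS.Lietz2026` (typist-7 g8, p543717, tree sha16 44bc56a4a5a94473, 535 l.).
Text of record = census pin `census/texts/Lietz2026/` (PDF sha16 286b22e0329a2db8; PDF page = printed page; line
numbers = text layer `pNNN.txt`).

PART B of two (lint split by topic, ≤ 400 lines each): the witness family — data, exact heat-flow solutions, Fourier
table, fixed ledger — is PART A `Summits.NavierStokesRegularity.NavierStokesRegularity.Theorems.SoloRefuteLietz2026Family`
(imported; no skeleton import there); this file adds the vorticity spectrum, the `dyShell` membership and the kill.

**Token = `Step_T133_uniform`** (skeleton l.351) — Thm 13.3 display (129) p.21 l.2–4 «Ω_k(t) ≤ C_phys(T) 2^{−β_ξ k},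
β_ξ = 6 log₂ φ > 3» read WITH its constant clause p.21 l.46–48 («C_phys(T) depends only on … initial
energy/enstrophy data, viscosity, Littlewood–Paley/Bernstein constants, retained Xi calibration constants, finite
front ledger constants») and Prop 14.1 p.21 l.61–63 («do not depend on sup_{t<T*}‖u(t)‖_{H^s}»): ONE ledger
function `F(ν, E(u₀), ‖∇u₀‖²₂)` bounds `Ω_k(t)·2^{β_ξ k}` along every classical solution on every `[0, T)`.
It is the binder `h133` of the skeleton's PROVED composition
`claim_of_steps_uniform : Step_T133_uniform → Step_T151 → ClaimedTheorem` (l.483) — the first CONSUMED binder in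
the printed dependency order (chair LETTERING PRE-NOTE 15:37:38Z: consumed binders `Step_T133_uniform` l.351 →
`Step_P141` l.365 → `Step_T151` l.379; Steps 2–10 incl. `Step_L121` are declared, not consumed).
**Class: FALSE LEMMA (countermodel)** — `not_Step_T133_uniform`: the TWO-SCALE PARALLEL SHEAR family
`u₀^{(N)}(x) = (0, a_N sin 2πx₀ + b_N sin 2πN x₀, 0)` on `𝕋³` (`a_N² = 2 − 2/(N² − 1)`, `b_N² = 2/(N² − 1)`,
`N = 2^k ≥ 2`): mean-zero, `C^∞`, divergence-free data — the print's class, Thm 2.1 p.4 l.3–6, = the skeleton's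
`IsDatum` — with the SAME ledger for every `N`: `E(u₀) = Torus.kineticEnergy u₀ = ½`,
`‖∇u₀‖²_{L²} = Torus.gradNormSq u₀ = 8π²`. Through each datum the exact global smooth Navier–Stokes solution is the
Stokes/heat flow (every Fourier mode decays by `e^{−4π²ν|ξ|²t}`, the nonlinear term vanishes identically, pressure
`0`; tree `TransversalModes.isClassicalNSSolutionOn_heatFlow_Ici`, Majda–Bertozzi 2002 §1.2), so the solution
binders `Torus.IsClassicalNSSolutionOn (Ico 0 T) ν 0 u p`, `u 0 = u₀` are met by a genuine solution (not the rest
state, not an opaque profile). The skeleton's sharp dyadic block `dyShell k` (l.102) contains `±2^k e₀`, and the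
vorticity spectrum of the datum is `|ω̂₀(ξ)|² = 4π²|ξ|²|û₀(ξ)|²`, so
`Om k (u₀^{(2^k)}) ≥ 4π² N² b_N²/2 = 4π²·N²/(N² − 1) > 4π²` for EVERY `k ≥ 1`, while the typed right side
`F(1, ½, 8π²)·2^{−β_ξ k}` tends to `0` (`β_ξ = 6 log₂ φ > 0`): at `ν = 1`, `T = 1`, `t = 0 ∈ [0, 1)` and `k` large
the display fails. HONEST SCOPE: the print-literal face `Step_T133` (one constant per solution and closed slab —
TRUE-type by smoothness) and the verbatim conditional `Step_P141` ((135): uniformity on a FINITE maximal interval —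
no blowing-up classical solution is known or constructed) carry no kernel object and are not attacked;
`Step_L121` (Lemma 12.1 (100), solution-independent `C_LP`) is false in print by low–high pairs (REF RETYPE family
F2) but is consumed by neither composition — recorded, no kernel object built here (parallel shear and Beltrami
flows have `T_k ≡ 0` and are not witnesses against (100)).

WHAT THIS IS NOT: not a claim about NS regularity or blow-up; not a claim about any author beyond the typed
locator. [cite: Lietz2026] [cite: MajdaBertozzi2002, §1.2] [cite: BahouriCheminDanchin2011, §2.2]
-/

set_option linter.dupNamespace false

noncomputable section

open Set Function MeasureTheory UnitAddTorus
open scoped InnerProductSpace ComplexConjugate ENNReal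

namespace Summit.NavierStokesRegularity.NavierStokesRegularity.Theorems.Lietz2026

open Literature.Analysis.FunctionSpaces Literature.Analysis.FunctionSpaces.Torus
open Literature.Analysis.FluidPDE Literature.Analysis.FluidPDE.TransversalModes

/-! ## Arithmetic: geometric decay beats any fixed constant -/

/-- For `0 ≤ r < 1`, `0 < c`: some `k ≥ k₀` has `F r^k < c`. -/
theorem exists_ge_mul_pow_lt {r : ℝ} (hr0 : 0 ≤ r) (hr1 : r < 1) (F : ℝ) {c : ℝ} (hc : 0 < c) (k₀ : ℕ) :
    ∃ k : ℕ, k₀ ≤ k ∧ F * r ^ k < c := by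
  have ht : Filter.Tendsto (fun k : ℕ => F * r ^ k) Filter.atTop (nhds 0) := by
    have := (tendsto_pow_atTop_nhds_zero_of_lt_one hr0 hr1).const_mul F
    simpa using this
  have hev : ∀ᶠ k : ℕ in Filter.atTop, F * r ^ k < c := ht.eventually (gt_mem_nhds hc)
  obtain ⟨K, hK⟩ := Filter.eventually_atTop.mp hev
  exact ⟨max K k₀, le_max_right _ _, hK _ (le_max_left _ _)⟩

/-- Dyadic form: for `β > 0`, `c > 0`, some `k ≥ k₀` has `F (2^k)^{-β} < c` (real exponent). -/
theorem exists_ge_mul_rpow_neg_lt {β : ℝ} (hβ : 0 < β) (F : ℝ) {c : ℝ} (hc : 0 < c) (k₀ : ℕ) :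
    ∃ k : ℕ, k₀ ≤ k ∧ F * ((2:ℝ) ^ (k:ℝ)) ^ (-β) < c := by
  have hr0 : (0:ℝ) ≤ (2:ℝ) ^ (-β) := Real.rpow_nonneg (by norm_num) _
  have hr1 : (2:ℝ) ^ (-β) < 1 := Real.rpow_lt_one_of_one_lt_of_neg (by norm_num) (by linarith)
  obtain ⟨k, hk, hlt⟩ := exists_ge_mul_pow_lt hr0 hr1 F hc k₀
  refine ⟨k, hk, ?_⟩
  have : ((2:ℝ) ^ (k:ℝ)) ^ (-β) = ((2:ℝ) ^ (-β)) ^ k := by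
    rw [← Real.rpow_natCast, ← Real.rpow_mul (by norm_num), ← Real.rpow_mul (by norm_num), mul_comm]
  rwa [this]

/-! ## Shell-membership helpers for `±m e₀` -/

/-- `±m e₀` lies in the coordinate box `[-M, M]³` iff `|m| ≤ M`. -/
theorem ax_mem_piFinset_Icc {m M : ℤ} (h : |m| ≤ M) :
    ax m ∈ Fintype.piFinset fun _ : Fin 3 => Finset.Icc (-M) M := by
  rw [Fintype.mem_piFinset]
  intro i
  rw [Finset.mem_Icc]
  by_cases hi : i = 0
  · subst hi; simp only [ax_zero_apply]; constructor <;> cases abs_le.mp h <;> omega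
  · have : ax m i = 0 := by simp [ax, hi]
    rw [this]; have := abs_nonneg m; constructor <;> omega

/-- `2 ≤ 2^k` for `k ≥ 1`. [folklore] -/
theorem two_le_two_pow {k : ℕ} (hk : 1 ≤ k) : 2 ≤ (2:ℕ) ^ k := by
  calc (2:ℕ) = 2 ^ 1 := by norm_num
    _ ≤ 2 ^ k := Nat.pow_le_pow_right (by norm_num) hk

/-! ## Vorticity of the family (the skeleton's `Om` is the vorticity block sum, `vort = BDSV.curl`)

`curl u₀^{(N)} = realTrigPoly (modes N) (ξ ↦ 2πi ξ × c_ξ)` and `‖2πi ξ × c_ξ‖² = 4π²|ξ|²‖c_ξ‖²` on the family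
(the modes are `ξ = m e₀`, the polarisation is `e₁ ⊥ ξ`). -/
section Curl

open Literature.Analysis.FluidPDE.IntermittentBeltrami

/-- Components of the coefficients: only the `x₁`-component is non-zero. [folklore] -/
theorem coef_apply (a b : ℝ) (N : ℕ) (k : Fin 3 → ℤ) (i : Fin 3) :
    coef a b N k i = if i = 1 then -Complex.I / 2 * (amp a b N k : ℂ) else 0 := by
  rw [coef, e1]
  by_cases hi : i = 1
  · subst hi; simp
  · simp [hi]

/-- Components of the curl coefficients of the family: `2πi ξ × (s e₁) = 2πi s (−ξ₂, 0, ξ₀)`. [folklore] -/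
theorem curlCoeff_coef_apply (a b : ℝ) (N : ℕ) (k : Fin 3 → ℤ) :
    curlCoeff (coef a b N) k 0 = (2 * Real.pi * Complex.I) * (-((k 2 : ℤ) : ℂ) * (-Complex.I / 2 * (amp a b N k : ℂ))) ∧
    curlCoeff (coef a b N) k 1 = 0 ∧
    curlCoeff (coef a b N) k 2 = (2 * Real.pi * Complex.I) * (((k 0 : ℤ) : ℂ) * (-Complex.I / 2 * (amp a b N k : ℂ))) := by
  obtain ⟨h0, h1, h2⟩ := cross_apply_fin (fun j => ((k j : ℤ) : ℂ)) (WithLp.ofLp (coef a b N k))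
  have hc : ∀ i, WithLp.ofLp (coef a b N k) i = coef a b N k i := fun i => rfl
  refine ⟨?_, ?_, ?_⟩
  · rw [curlCoeff_apply, h0, hc, hc, coef_apply, coef_apply]; simp
  · rw [curlCoeff_apply, h1, hc, hc, coef_apply, coef_apply]; simp
  · rw [curlCoeff_apply, h2, hc, hc, coef_apply, coef_apply]; simp

/-- **`|ω̂(ξ)|² = 4π²|ξ|²|û(ξ)|²` on the family.** [folklore] -/
theorem norm_sq_curlCoeff_coef (a b : ℝ) (N : ℕ) (k : Fin 3 → ℤ) :
    ‖curlCoeff (coef a b N) k‖ ^ 2 = 4 * Real.pi ^ 2 * freqNormSq k * ‖coef a b N k‖ ^ 2 := by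
  obtain ⟨h0, h1, h2⟩ := curlCoeff_coef_apply a b N k
  rw [EuclideanSpace.norm_sq_eq, Fin.sum_univ_three, h0, h1, h2, norm_coef_sq, freqNormSq,
    Fin.sum_univ_three]
  by_cases hk : k 1 = 0 ∧ k 2 = 0
  · obtain ⟨hk1, hk2⟩ := hk
    simp only [hk1, hk2, Int.cast_zero, neg_zero, zero_mul, mul_zero, norm_zero, ne_eq,
      OfNat.ofNat_ne_zero, not_false_eq_true, zero_pow, zero_add, Complex.norm_mul, Complex.norm_ofNat,
      Complex.norm_real, Complex.norm_I, Complex.norm_intCast, norm_neg, norm_div, Real.norm_eq_abs, mul_one]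
    simp only [mul_pow, sq_abs]
    ring
  · have hamp : amp a b N k = 0 := by rw [amp, if_neg hk]
    simp [hamp]

/-- Conjugate symmetry of the curl coefficients of the family. [folklore] -/
theorem isConjSymm_curlCoeff_coef (a b : ℝ) (N : ℕ) : IsConjSymm (curlCoeff (coef a b N)) := by
  intro k
  obtain ⟨h0, h1, h2⟩ := curlCoeff_coef_apply a b N k
  obtain ⟨g0, g1, g2⟩ := curlCoeff_coef_apply a b N (-k)
  ext i
  fin_cases i
  · show curlCoeff (coef a b N) (-k) 0 = starRingEnd ℂ (curlCoeff (coef a b N) k 0)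
    rw [g0, h0, amp_neg]
    simp only [Pi.neg_apply, Int.cast_neg, map_mul, map_neg, map_div₀, Complex.conj_I, Complex.conj_ofReal,
      map_ofNat, map_intCast, Complex.ofReal_neg]
    ring
  · show curlCoeff (coef a b N) (-k) 1 = starRingEnd ℂ (curlCoeff (coef a b N) k 1)
    rw [g1, h1, map_zero]
  · show curlCoeff (coef a b N) (-k) 2 = starRingEnd ℂ (curlCoeff (coef a b N) k 2)
    rw [g2, h2, amp_neg]
    simp only [Pi.neg_apply, Int.cast_neg, map_mul, map_div₀, map_neg, Complex.conj_I, Complex.conj_ofReal,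
      map_ofNat, map_intCast, Complex.ofReal_neg]
    ring

/-- **The vorticity of the datum** is the trigonometric polynomial with the curl coefficients. [folklore] -/
theorem curl_datum (a b : ℝ) (N : ℕ) :
    BDSV.curl (datum a b N) = realTrigPoly (modes N) (curlCoeff (coef a b N)) := by
  funext x
  exact curl_realTrigPoly (modes N) (coef a b N) x

/-- Fourier coefficients of the vorticity of the datum. [folklore] -/
theorem mFourierCoeff_curl_datum (a b : ℝ) (N : ℕ) (k : Fin 3 → ℤ) :
    mFourierCoeff (EuclideanSpace.complexify ∘ BDSV.curl (datum a b N)) k =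
      if k ∈ modes N then curlCoeff (coef a b N) k else 0 := by
  rw [curl_datum]
  exact mFourierCoeff_realTrigPoly (modes_symm N) (isConjSymm_curlCoeff_coef a b N) k

/-- **Vorticity spectrum of the datum**: `|ω̂₀(ξ)|² = 4π²|ξ|² · amp(ξ)²/4` on the modes, `0` elsewhere. [folklore] -/
theorem norm_sq_mFourierCoeff_curl_datum (a b : ℝ) (N : ℕ) (ξ : Fin 3 → ℤ) :
    ‖mFourierCoeff (EuclideanSpace.complexify ∘ BDSV.curl (datum a b N)) ξ‖ ^ 2 =
      4 * Real.pi ^ 2 * freqNormSq ξ * ‖mFourierCoeff (EuclideanSpace.complexify ∘ datum a b N) ξ‖ ^ 2 := by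
  rw [mFourierCoeff_curl_datum, mFourierCoeff_datum]
  split_ifs with h
  · exact norm_sq_curlCoeff_coef a b N ξ
  · simp

end Curl

/-! ## The kill: `¬ Step_T133_uniform` ((129) with its ledger-constant clause, t = 0, N = 2^k → ∞) -/
section Kill

open Literature.Claims.NS.Lietz2026
open Literature.Claims.NS.Higgins2026 (T3 E3 C3 Z3 coeff)

/-- The skeleton's `vort` (l.87) is the tree's `BDSV.curl` — identical formula. [folklore] -/
theorem vort_eq_curl (v : UnitAddTorus (Fin 3) → EuclideanSpace ℝ (Fin 3)) : vort v = BDSV.curl v := rfl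

/-- `φ > 1`. [folklore] -/
theorem one_lt_phi : 1 < phi := by
  have h5 : 1 < Real.sqrt 5 := by
    rw [show (1:ℝ) = Real.sqrt 1 by simp]
    exact Real.sqrt_lt_sqrt (by norm_num) (by norm_num)
  rw [phi]
  linarith

/-- `β_ξ = 6 log₂ φ > 0` (the print has `β_ξ > 3`; positivity is all the kill uses). [cite: Lietz2026, Thm 7.1 (34) p.7 l.37–52] -/
theorem betaXi_pos : 0 < betaXi := by
  unfold betaXi
  exact mul_pos (by norm_num) (Real.logb_pos one_lt_two one_lt_phi)

/-- Geometric decay in the skeleton's spelling `2^{−(β k)}` beats any fixed constant. [folklore] -/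
theorem exists_ge_mul_two_rpow_lt {β : ℝ} (hβ : 0 < β) (F : ℝ) {c : ℝ} (hc : 0 < c) (k₀ : ℕ) :
    ∃ k : ℕ, k₀ ≤ k ∧ F * (2:ℝ) ^ (-(β * k)) < c := by
  obtain ⟨k, hk, hlt⟩ := exists_ge_mul_rpow_neg_lt hβ F hc k₀
  refine ⟨k, hk, ?_⟩
  have : (2:ℝ) ^ (-(β * k)) = ((2:ℝ) ^ (k:ℝ)) ^ (-β) := by
    rw [← Real.rpow_mul (by norm_num), show (k:ℝ) * -β = -(β * k) by ring]
  rwa [this]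

/-- `(2^k)² = 2^{2k}` in `ℝ`. [folklore] -/
theorem two_pow_sq (k : ℕ) : (((2 ^ k : ℕ) : ℤ) : ℝ) ^ 2 = (2:ℝ) ^ (2 * k) := by
  push_cast
  rw [← pow_mul, mul_comm]

/-- **`±2^k e₀` lie in the sharp dyadic block `dyShell k`** (`|n|² = 2^{2k}`: `2^{2k} < 2·2^{2k}` and
`2^{2k} ≤ 2·2^{2k}`; coordinates in `[−2^{k+1}, 2^{k+1}]`). [folklore] -/
theorem ax_pow_mem_dyShell (k : ℕ) :
    ax ((2 ^ k : ℕ) : ℤ) ∈ dyShell k ∧ ax (-((2 ^ k : ℕ) : ℤ)) ∈ dyShell k := by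
  have hbox : |((2 ^ k : ℕ) : ℤ)| ≤ 2 ^ (k + 1) := by
    rw [abs_of_nonneg (by positivity)]
    push_cast
    exact pow_le_pow_right₀ (by norm_num) (Nat.le_succ k)
  have hbox' : |(-((2 ^ k : ℕ) : ℤ))| ≤ 2 ^ (k + 1) := by rwa [abs_neg]
  have hpos : (0:ℝ) < (2:ℝ) ^ (2 * k) := by positivity
  constructor
  · simp only [dyShell, Finset.mem_filter]
    refine ⟨ax_mem_piFinset_Icc hbox, ?_⟩
    rw [freqNormSq_ax, two_pow_sq]
    constructor <;> linarith
  · simp only [dyShell, Finset.mem_filter]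
    refine ⟨ax_mem_piFinset_Icc hbox', ?_⟩
    rw [freqNormSq_ax, Int.cast_neg, neg_sq, two_pow_sq]
    constructor <;> linarith

/-- **Shell enstrophy of the two-scale shear datum in the block of `N = 2^k`**:
`Ω_k(u₀^{(N)}) ≥ Σ_{±N e₀} |ω̂₀|² = 4π² N² · b²/2` (vorticity spectrum `|ω̂₀(ξ)|² = 4π²|ξ|²|û₀(ξ)|²`).
[cite: Lietz2026, §3 (9) p.4 l.62–66] -/
theorem Om_datum_ge {k : ℕ} (hk : 1 ≤ k) (a b : ℝ) :
    4 * Real.pi ^ 2 * (2:ℝ) ^ (2 * k) * (b ^ 2 / 2) ≤ Om k (datum a b (2 ^ k)) := by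
  have hN2 : 2 ≤ 2 ^ k := two_le_two_pow hk
  obtain ⟨hm, hm'⟩ := ax_pow_mem_dyShell k
  have hOm : Om k (datum a b (2 ^ k)) = ∑ n ∈ dyShell k, (4 * Real.pi ^ 2 * freqNormSq n) *
      ‖mFourierCoeff (EuclideanSpace.complexify ∘ datum a b (2 ^ k)) n‖ ^ 2 := by
    simp only [Om, coeff, vort_eq_curl]
    exact Finset.sum_congr rfl fun n _ => by rw [norm_sq_mFourierCoeff_curl_datum]
  have hw : ∀ ξ : Fin 3 → ℤ, 0 ≤ 4 * Real.pi ^ 2 * freqNormSq ξ := fun ξ =>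
    mul_nonneg (by positivity) (freqNormSq_nonneg ξ)
  have h := sum_weight_norm_sq_datum_ge a b hN2 (dyShell k) hm hm' (fun n => 4 * Real.pi ^ 2 * freqNormSq n) hw
  rw [freqNormSq_ax, freqNormSq_ax, Int.cast_neg, neg_sq, two_pow_sq] at h
  rw [hOm]
  linarith

/-- **Normalised family**: `Ω_k(u₀^{(2^k)}) > 4π²` for every `k ≥ 1`, with the SAME ledger `E = ½`,
`‖∇u₀‖²₂ = 8π²` (`N² b_N²/2 = N²/(N² − 1) > 1`). [cite: Lietz2026, Thm 13.3 (129) p.21 l.2–4, l.46–48] -/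
theorem Om_datum_norm_gt {k : ℕ} (hk : 1 ≤ k) :
    4 * Real.pi ^ 2 < Om k (datum (aN (2 ^ k)) (bN (2 ^ k)) (2 ^ k)) := by
  have hN2 : 2 ≤ 2 ^ k := two_le_two_pow hk
  have h1 := N_sq_bN_sq_div_two_gt_one hN2
  have h2 := Om_datum_ge hk (aN (2 ^ k)) (bN (2 ^ k))
  have hsq : ((2 ^ k : ℕ) : ℝ) ^ 2 = (2:ℝ) ^ (2 * k) := by push_cast; rw [← pow_mul, mul_comm]
  rw [hsq] at h1
  have h4 : (0:ℝ) < 4 * Real.pi ^ 2 := by positivity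
  nlinarith

/-- **`¬ Step_T133_uniform`** — Thm 13.3 (129) p.21 l.2–4 with its constant clause l.46–48 / Prop 14.1
l.61–63 (one ledger function `F(ν, E(u₀), ‖∇u₀‖²₂)` bounding `Ω_k(t)·2^{β_ξ k}` along every classical
solution on every `[0, T)`) FAILS: at `ν = 1`, `T = 1`, `t = 0`, along the exact heat/Stokes solutions through
the two-scale shear data `u₀^{(2^k)}` (all with `E = ½`, `‖∇u₀‖²₂ = 8π²`), the left side exceeds `4π²` for
every `k ≥ 1` while the right side `F(1, ½, 8π²)·2^{−β_ξ k}` tends to `0`. [cite: Lietz2026, Thm 13.3 (129) p.21 l.2–4, l.46–48; Prop 14.1 (135) p.21 l.61–63] -/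
theorem not_Step_T133_uniform : ¬ Step_T133_uniform := by
  rintro ⟨F, hF⟩
  have h4 : (0:ℝ) < 4 * Real.pi ^ 2 := by positivity
  obtain ⟨k, hk1, hlt⟩ := exists_ge_mul_two_rpow_lt betaXi_pos (F 1 (1 / 2) (8 * Real.pi ^ 2)) h4 1
  have hN2 : 2 ≤ 2 ^ k := two_le_two_pow hk1
  have hN0 : 2 ^ k ≠ 0 := by omega
  have hdat : IsDatum (datum (aN (2 ^ k)) (bN (2 ^ k)) (2 ^ k)) :=
    ⟨isSmooth_datum _ _ _, isDivFree_datum _ _ _, hasZeroMean_datum _ _ hN0⟩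
  have h := hF 1 one_pos _ hdat 1 one_pos (flow 1 (aN (2 ^ k)) (bN (2 ^ k)) (2 ^ k)) (fun _ _ => (0:ℝ))
    (isClassicalNSSolutionOn_flow_Ico 1 _ _ _ 1) (flow_zero 1 _ _ _) k 0 ⟨le_rfl, one_pos⟩
  rw [flow_zero, kineticEnergy_datum_norm hN2, gradNormSq_datum_norm hN2] at h
  have hgt := Om_datum_norm_gt hk1
  linarith

/-- By-import type probe (§1g): the negation is of the skeleton decl itself. -/
example : ¬ Literature.Claims.NS.Lietz2026.Step_T133_uniform := not_Step_T133_uniform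

end Kill

end Summit.NavierStokesRegularity.NavierStokesRegularity.Theorems.Lietz2026
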